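import Summits.HodgeConjecture.HodgeConjecture.Theorems.F0P3cStCharTSLevelFamily        -- ★ p849745 «LEVEL-FAMILY★» (this seat): `C n := ι⁻¹(M_T ∩ K_n)`; brings ★ p849718∕p849667∕p849631∕p849564∕p849333∕p849400
import HarnessLib

/-!
# F0 · P3c · line LH6 «StCharTS» — «HSHELL-GLUE★»: a TWO-COSET IDENTITY for `Δ·O^{can}` on the torus `M_T` yields the shell clause `hshell` of ★ p849718 ∕ p849745
# for `torusTransform` on the parameter torus `M = E_vˣ × E¹_v`
# [Rogawski1990, §12.7 L. 12.7.1 (proof) p. 191; L. 12.7.2 (proof) pp. 193–194; §4.9 (4.9.4) p. 56]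

Cell `pub/hodgecm-mathlib`, crux H413 = `stmt-HodgeConjecture-24833` (`--supports` lane, helper), route HCCMUnconditional; seat LH6-p05 (g2); road (D) owner LH6-p03 (g0)
06:10:55Z «HSHELL-GLUE★ useful = yes» (serves (TOR)'s `hshell` and (D)'s `hOG`); (TOR) integrator LH6-p01 (g2).  THEOREMS ONLY, sorry-free, no definition ∕ instance ∕
notation ∕ named fact.  OBJECTS (inline ∕ named terms of record): `M`, `M_c` (★ p849333), `ω` (★ p849140), `ι = torusChart ∕ torusChartHom` (★ p849564),
`torusTransform L v mQv μM φ m = (2 μM(M_c))⁻¹ · Δ(ι m) · O^{can}_{ι m}(φ)` (★ p849564), a torus level `C_T ≤ M_T` (e.g. `(𝓘.K n).subgroupOf M_T`) and its pull-back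
`C := C_T.comap ι ≤ M` (the ★ p849745 level family).
THE GLUE.  Road (D)'s D3-ii-G chain (★ p849606 `normalizedOrbitalIntegral_eq_twoCoset` + its Ψ-producer + ★ F1-G + «SHELL-WEIGHT★») delivers, for the shell test function
`φ = 𝟙_{K_n ι(u) K_n}`, a TWO-COSET IDENTITY ON `M_T`:  `Δ(t) · O^{can}_t(φ) = κ_T · (𝟙_{ι(u)·C_T}(t) + 𝟙_{ι(ω u)·C_T}(t))` for EVERY `t ∈ M_T` (cosets written as
`{t | b⁻¹ t ∈ C_T}` as in ★ p849606).  This file turns any such identity into the `M`-side clause consumed by ★ `surj_torusTransform_of_levelShells`: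
* `reflect_inv_mul` ∕ `torusChart_reflect_mem_iff` ∕ `torusChart_inv_mul_mem_iff` — bookkeeping: `ω` as a homomorphism; `ι(ω x) ∈ C_T ↔ ι x ∈ C_T` for an `ω`-stable level;
* `indicator_coset_torusChart` ∕ `indicator_reflectCoset_torusChart` — `𝟙_{ι(u)·C_T}(ι m) = 𝟙_{u·C}(m)` and `𝟙_{ι(ω u)·C_T}(ι m) = 𝟙_{u·C}(ω m)`;
* **`torusTransform_eq_of_twoCoset`** — the identity above ⟹ `torusTransform … φ = ((2 μM(M_c))⁻¹ κ_T) · (𝟙_{u·C} + 𝟙_{u·C}∘ω)`;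
* `inv_two_mul_measureReal_torusCompactPart_ne_zero` — `(2 μM(M_c))⁻¹ ≠ 0` for a Haar `μM` (★ p849333), so the constant is non-zero when `κ_T ≠ 0`;
* **`hshell_of_twoCoset`** — the `∃ φ …` clause of ★ p849718∕p849745 `hshell` at `(n, u)` from: a smooth `φ` supported in `hyperbolicSet` + a two-coset identity with
  `κ_T ≠ 0`.
HONEST LABEL: HC_CM is proved only modulo the 7 printed citations (2 remaining: hLiu418 = stmt-HodgeConjecture-24832, h413 = stmt-HodgeConjecture-24833) until rung 0
closes; count-neutral bookkeeping (the two-coset identity itself is road (D)'s analytic content).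

## References
* [Rogawski1990] J. D. Rogawski, *Automorphic Representations of Unitary Groups in Three Variables*, Ann. of Math. Stud. 123 (1990): §4.9 (4.9.4) p. 56; §12.5 p. 183;
  §12.7 L. 12.7.1 (proof) p. 191, L. 12.7.2 (proof) pp. 193–194.
-/

set_option autoImplicit false
-- the mandated namespace has the single-problem summit's repeated segment (`HodgeConjecture.HodgeConjecture`)
set_option linter.dupNamespace false

noncomputable section

open NumberField IsDedekindDomain MeasureTheory Measure Topology Filter
open scoped NNReal ENNReal Pointwise MatrixGroups
open Literature.NumberTheory.Rogawski1990 Literature.NumberTheory.Automorphic Literature.NumberTheory.Automorphic.UnitaryGroup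

namespace Summit.HodgeConjecture.HodgeConjecture.Cruxes.H413.F0P3cStCharTSHShellGlue

variable (L : Type) [Field L] [NumberField L] [IsCMField L] (v : HeightOneSpectrum (𝓞 ↥(maximalRealSubfield L)))

/-! ## §1 Bookkeeping: `ω` through `ι` and the level -/

/-- `ω` on inverses and products: `ω(x⁻¹ * y) = (ω x)⁻¹ * ω y` (`ω` is a homomorphism of the abelian `M`, ★ `reflect_mul`). [cite: Rogawski1990, §12.2 p. 173] -/
theorem reflect_inv_mul (x y : ((UnitaryGroup.LocalRing L v)ˣ × ↥(normOneUnits (conjLocal L (IsCMField.complexConj L) v)))) : (fun p : ((UnitaryGroup.LocalRing L v)ˣ × ↥(normOneUnits (conjLocal L (IsCMField.complexConj L) v))) => ((Units.map ((conjLocal L (IsCMField.complexConj L) v : UnitaryGroup.LocalRing L v →+* UnitaryGroup.LocalRing L v) : UnitaryGroup.LocalRing L v →* UnitaryGroup.LocalRing L v) p.1)⁻¹, p.2)) (x⁻¹ * y) = ((fun p : ((UnitaryGroup.LocalRing L v)ˣ × ↥(normOneUnits (conjLocal L (IsCMField.complexConj L) v))) => ((Units.map ((conjLocal L (IsCMField.complexConj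 L) v : UnitaryGroup.LocalRing L v →+* UnitaryGroup.LocalRing L v) : UnitaryGroup.LocalRing L v →* UnitaryGroup.LocalRing L v) p.1)⁻¹, p.2)) x)⁻¹ * (fun p : ((UnitaryGroup.LocalRing L v)ˣ × ↥(normOneUnits (conjLocal L (IsCMField.complexConj L) v))) => ((Units.map ((conjLocal L (IsCMField.complexConj L) v : UnitaryGroup.LocalRing L v →+* UnitaryGroup.LocalRing L v) : UnitaryGroup.LocalRing L v →* UnitaryGroup.LocalRing L v) p.1)⁻¹, p.2)) y := by
  let ωh : ((UnitaryGroup.LocalRing L v)ˣ × ↥(normOneUnits (conjLocal L (IsCMField.complexConj L) v))) →* ((UnitaryGroup.LocalRing L v)ˣ × ↥(normOneUnits (conjLocal L (IsCMField.complexConj L) v))) :=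
    { toFun := (fun p : ((UnitaryGroup.LocalRing L v)ˣ × ↥(normOneUnits (conjLocal L (IsCMField.complexConj L) v))) => ((Units.map ((conjLocal L (IsCMField.complexConj L) v : UnitaryGroup.LocalRing L v →+* UnitaryGroup.LocalRing L v) : UnitaryGroup.LocalRing L v →* UnitaryGroup.LocalRing L v) p.1)⁻¹, p.2)), map_one' := by simp, map_mul' := F0P3cStCharTSTorusRay.reflect_mul L v }
  have h : ∀ z : ((UnitaryGroup.LocalRing L v)ˣ × ↥(normOneUnits (conjLocal L (IsCMField.complexConj L) v))), (fun p : ((UnitaryGroup.LocalRing L v)ˣ × ↥(normOneUnits (conjLocal L (IsCMField.complexConj L) v))) => ((Units.map ((conjLocal L (IsCMField.complexConj L) v : UnitaryGroup.LocalRing L v →+* UnitaryGroup.LocalRing L v) : UnitaryGroup.LocalRing L v →* UnitaryGroup.LocalRing L v) p.1)⁻¹, p.2)) z = ωh z := fun _ => rfl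
  rw [h, h, h, map_mul, map_inv]

/-- For an `ω`-stable level `C_T` (read through `ι`): `ι(ω x) ∈ C_T ↔ ι x ∈ C_T`. [cite: Rogawski1990, §12.2 p. 173] -/
theorem torusChart_reflect_mem_iff (CT : Subgroup ↥(cmBorelTriple L 3 v).M)
    (hCω : ∀ x : ((UnitaryGroup.LocalRing L v)ˣ × ↥(normOneUnits (conjLocal L (IsCMField.complexConj L) v))), F0P3cStCharTSTorusDefs.torusChart L v x ∈ CT → F0P3cStCharTSTorusDefs.torusChart L v ((fun p : ((UnitaryGroup.LocalRing L v)ˣ × ↥(normOneUnits (conjLocal L (IsCMField.complexConj L) v))) => ((Units.map ((conjLocal L (IsCMField.complexConj L) v : UnitaryGroup.LocalRing L v →+* UnitaryGroup.LocalRing L v) : UnitaryGroup.LocalRing L v →* UnitaryGroup.LocalRing L v) p.1)⁻¹, p.2)) x) ∈ CT) (x : ((UnitaryGroup.LocalRing L v)ˣ × ↥(normOneUnits (conjLocal L (IsCMField.complexConj L) v)))) :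
    F0P3cStCharTSTorusDefs.torusChart L v ((fun p : ((UnitaryGroup.LocalRing L v)ˣ × ↥(normOneUnits (conjLocal L (IsCMField.complexConj L) v))) => ((Units.map ((conjLocal L (IsCMField.complexConj L) v : UnitaryGroup.LocalRing L v →+* UnitaryGroup.LocalRing L v) : UnitaryGroup.LocalRing L v →* UnitaryGroup.LocalRing L v) p.1)⁻¹, p.2)) x) ∈ CT ↔ F0P3cStCharTSTorusDefs.torusChart L v x ∈ CT := by
  refine ⟨fun h => ?_, hCω x⟩
  have h2 := hCω _ h
  have hωω := F0P3cStCharTSTorusRay.reflect_reflect L v x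
  simp only at hωω h2
  rwa [hωω] at h2

set_option synthInstance.maxHeartbeats 400000 in
/-- `(ι a)⁻¹ · ι m ∈ C_T ↔ a⁻¹ m ∈ ι⁻¹(C_T)` (`ι` is a homomorphism). [cite: Rogawski1990, §12.2 p. 173] -/
theorem torusChart_inv_mul_mem_iff (CT : Subgroup ↥(cmBorelTriple L 3 v).M) (a m : ((UnitaryGroup.LocalRing L v)ˣ × ↥(normOneUnits (conjLocal L (IsCMField.complexConj L) v)))) :
    (F0P3cStCharTSTorusDefs.torusChart L v a)⁻¹ * F0P3cStCharTSTorusDefs.torusChart L v m ∈ (CT : Set ↥(cmBorelTriple L 3 v).M) ↔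
      a⁻¹ * m ∈ (CT.comap (F0P3cStCharTSTorusDefs.torusChartHom L v) : Subgroup ((UnitaryGroup.LocalRing L v)ˣ × ↥(normOneUnits (conjLocal L (IsCMField.complexConj L) v)))) := by
  have hsplit : F0P3cStCharTSTorusDefs.torusChart L v m =
      F0P3cStCharTSTorusDefs.torusChart L v a * F0P3cStCharTSTorusDefs.torusChart L v (a⁻¹ * m) := by
    have h := (F0P3cStCharTSTorusDefs.torusChartHom L v).map_mul a (a⁻¹ * m)
    rw [mul_inv_cancel_left] at h
    exact h
  rw [SetLike.mem_coe, Subgroup.mem_comap, F0P3cStCharTSTorusDefs.torusChartHom_apply, hsplit, inv_mul_cancel_left]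

/-- **`𝟙_{ι(u)·C_T}(ι m) = 𝟙_{u·C}(m)`** for `C = ι⁻¹(C_T)` (`ι` is a homomorphism). [cite: Rogawski1990, §12.7 L. 12.7.1 (proof) p. 191] -/
theorem indicator_coset_torusChart (CT : Subgroup ↥(cmBorelTriple L 3 v).M) (u m : ((UnitaryGroup.LocalRing L v)ˣ × ↥(normOneUnits (conjLocal L (IsCMField.complexConj L) v)))) :
    {t : ↥(cmBorelTriple L 3 v).M | (F0P3cStCharTSTorusDefs.torusChart L v u)⁻¹ * t ∈ (CT : Set ↥(cmBorelTriple L 3 v).M)}.indicator (fun _ => (1 : ℂ))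
        (F0P3cStCharTSTorusDefs.torusChart L v m) =
      (u • ((CT.comap (F0P3cStCharTSTorusDefs.torusChartHom L v) : Subgroup ((UnitaryGroup.LocalRing L v)ˣ × ↥(normOneUnits (conjLocal L (IsCMField.complexConj L) v)))) : Set ((UnitaryGroup.LocalRing L v)ˣ × ↥(normOneUnits (conjLocal L (IsCMField.complexConj L) v))))).indicator (fun _ => (1 : ℂ)) m := by
  have hiff : F0P3cStCharTSTorusDefs.torusChart L v m ∈
      {t : ↥(cmBorelTriple L 3 v).M | (F0P3cStCharTSTorusDefs.torusChart L v u)⁻¹ * t ∈ (CT : Set ↥(cmBorelTriple L 3 v).M)} ↔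
      m ∈ u • ((CT.comap (F0P3cStCharTSTorusDefs.torusChartHom L v) : Subgroup ((UnitaryGroup.LocalRing L v)ˣ × ↥(normOneUnits (conjLocal L (IsCMField.complexConj L) v)))) : Set ((UnitaryGroup.LocalRing L v)ˣ × ↥(normOneUnits (conjLocal L (IsCMField.complexConj L) v)))) := by
    rw [Set.mem_setOf_eq, torusChart_inv_mul_mem_iff, mem_leftCoset_iff, SetLike.mem_coe]
  by_cases hm : m ∈ u • ((CT.comap (F0P3cStCharTSTorusDefs.torusChartHom L v) : Subgroup ((UnitaryGroup.LocalRing L v)ˣ × ↥(normOneUnits (conjLocal L (IsCMField.complexConj L) v)))) : Set ((UnitaryGroup.LocalRing L v)ˣ × ↥(normOneUnits (conjLocal L (IsCMField.complexConj L) v))))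
  · rw [Set.indicator_of_mem hm, Set.indicator_of_mem (hiff.2 hm)]
  · rw [Set.indicator_of_notMem hm, Set.indicator_of_notMem (fun h => hm (hiff.1 h))]

/-- **`𝟙_{ι(ω u)·C_T}(ι m) = 𝟙_{u·C}(ω m)`** for an `ω`-stable level (`ω` involutive homomorphism). [cite: Rogawski1990, §12.7 L. 12.7.1 (proof) p. 191; §12.2 p. 173] -/
theorem indicator_reflectCoset_torusChart (CT : Subgroup ↥(cmBorelTriple L 3 v).M)
    (hCω : ∀ x : ((UnitaryGroup.LocalRing L v)ˣ × ↥(normOneUnits (conjLocal L (IsCMField.complexConj L) v))), F0P3cStCharTSTorusDefs.torusChart L v x ∈ CT → F0P3cStCharTSTorusDefs.torusChart L v ((fun p : ((UnitaryGroup.LocalRing L v)ˣ × ↥(normOneUnits (conjLocal L (IsCMField.complexConj L) v))) => ((Units.map ((conjLocal L (IsCMField.complexConj L) v : UnitaryGroup.LocalRing L v →+* UnitaryGroup.LocalRing L v) : UnitaryGroup.LocalRing L v →* UnitaryGroup.LocalRing L v) p.1)⁻¹, p.2)) x) ∈ CT) (u m : ((UnitaryGroup.LocalRing L v)ˣ ×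 ↥(normOneUnits (conjLocal L (IsCMField.complexConj L) v)))) :
    {t : ↥(cmBorelTriple L 3 v).M | (F0P3cStCharTSTorusDefs.torusChart L v ((fun p : ((UnitaryGroup.LocalRing L v)ˣ × ↥(normOneUnits (conjLocal L (IsCMField.complexConj L) v))) => ((Units.map ((conjLocal L (IsCMField.complexConj L) v : UnitaryGroup.LocalRing L v →+* UnitaryGroup.LocalRing L v) : UnitaryGroup.LocalRing L v →* UnitaryGroup.LocalRing L v) p.1)⁻¹, p.2)) u))⁻¹ * t ∈ (CT : Set ↥(cmBorelTriple L 3 v).M)}.indicator (fun _ => (1 : ℂ))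
        (F0P3cStCharTSTorusDefs.torusChart L v m) =
      (u • ((CT.comap (F0P3cStCharTSTorusDefs.torusChartHom L v) : Subgroup ((UnitaryGroup.LocalRing L v)ˣ × ↥(normOneUnits (conjLocal L (IsCMField.complexConj L) v)))) : Set ((UnitaryGroup.LocalRing L v)ˣ × ↥(normOneUnits (conjLocal L (IsCMField.complexConj L) v))))).indicator (fun _ => (1 : ℂ)) ((fun p : ((UnitaryGroup.LocalRing L v)ˣ × ↥(normOneUnits (conjLocal L (IsCMField.complexConj L) v))) => ((Units.map ((conjLocal L (IsCMField.complexConj L) v : UnitaryGroup.LocalRing L v →+* UnitaryGroup.LocalRing L v) : UnitaryGroup.LocalRing L v →* UnitaryGroup.LocalRing L v) p.1)⁻¹, p.2)) m) := by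
  -- both sides are `𝟙[ι((ω u)⁻¹ m) ∈ C_T]` resp. `𝟙[ι(u⁻¹ ω m) ∈ C_T]`, and `ω((ω u)⁻¹ m) = u⁻¹ ω m`
  have hkey : F0P3cStCharTSTorusDefs.torusChart L v (((fun p : ((UnitaryGroup.LocalRing L v)ˣ × ↥(normOneUnits (conjLocal L (IsCMField.complexConj L) v))) => ((Units.map ((conjLocal L (IsCMField.complexConj L) v : UnitaryGroup.LocalRing L v →+* UnitaryGroup.LocalRing L v) : UnitaryGroup.LocalRing L v →* UnitaryGroup.LocalRing L v) p.1)⁻¹, p.2)) u)⁻¹ * m) ∈ CT ↔ F0P3cStCharTSTorusDefs.torusChart L v (u⁻¹ * (fun p : ((UnitaryGroup.LocalRing L v)ˣ × ↥(normOneUnits (conjLocal L (IsCMField.complexConj L) v))) => ((Units.map ((conjLocal L (IsCMField.complexConj L) v : UnitaryGroup.LocalRing L v →+* UnitaryGroup.LocalRing L v) : UnitaryGroup.LocalRing L v →* UnitaryGroup.LocalRing L v) p.1)⁻¹, p.2)) m) ∈ CT := by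
    rw [← torusChart_reflect_mem_iff L v CT hCω (((fun p : ((UnitaryGroup.LocalRing L v)ˣ × ↥(normOneUnits (conjLocal L (IsCMField.complexConj L) v))) => ((Units.map ((conjLocal L (IsCMField.complexConj L) v : UnitaryGroup.LocalRing L v →+* UnitaryGroup.LocalRing L v) : UnitaryGroup.LocalRing L v →* UnitaryGroup.LocalRing L v) p.1)⁻¹, p.2)) u)⁻¹ * m), reflect_inv_mul]
    have hωω := F0P3cStCharTSTorusRay.reflect_reflect L v u
    simp only at hωω ⊢
    rw [hωω]
  have hiff : F0P3cStCharTSTorusDefs.torusChart L v m ∈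
      {t : ↥(cmBorelTriple L 3 v).M | (F0P3cStCharTSTorusDefs.torusChart L v ((fun p : ((UnitaryGroup.LocalRing L v)ˣ × ↥(normOneUnits (conjLocal L (IsCMField.complexConj L) v))) => ((Units.map ((conjLocal L (IsCMField.complexConj L) v : UnitaryGroup.LocalRing L v →+* UnitaryGroup.LocalRing L v) : UnitaryGroup.LocalRing L v →* UnitaryGroup.LocalRing L v) p.1)⁻¹, p.2)) u))⁻¹ * t ∈ (CT : Set ↥(cmBorelTriple L 3 v).M)} ↔
      (fun p : ((UnitaryGroup.LocalRing L v)ˣ × ↥(normOneUnits (conjLocal L (IsCMField.complexConj L) v))) => ((Units.map ((conjLocal L (IsCMField.complexConj L) v : UnitaryGroup.LocalRing L v →+* UnitaryGroup.LocalRing L v) : UnitaryGroup.LocalRing L v →* UnitaryGroup.LocalRing L v) p.1)⁻¹, p.2)) m ∈ u • ((CT.comap (F0P3cStCharTSTorusDefs.torusChartHom L v) : Subgroup ((UnitaryGroup.LocalRing L v)ˣ × ↥(normOneUnits (conjLocal L (IsCMField.complexConj L) v)))) : Set ((UnitaryGroup.LocalRing L v)ˣ × ↥(normOneUnits (conjLocal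 L (IsCMField.complexConj L) v)))) := by
    rw [Set.mem_setOf_eq, torusChart_inv_mul_mem_iff, mem_leftCoset_iff, SetLike.mem_coe, Subgroup.mem_comap, Subgroup.mem_comap,
      F0P3cStCharTSTorusDefs.torusChartHom_apply, F0P3cStCharTSTorusDefs.torusChartHom_apply]
    exact hkey
  by_cases hm : (fun p : ((UnitaryGroup.LocalRing L v)ˣ × ↥(normOneUnits (conjLocal L (IsCMField.complexConj L) v))) => ((Units.map ((conjLocal L (IsCMField.complexConj L) v : UnitaryGroup.LocalRing L v →+* UnitaryGroup.LocalRing L v) : UnitaryGroup.LocalRing L v →* UnitaryGroup.LocalRing L v) p.1)⁻¹, p.2)) m ∈ u • ((CT.comap (F0P3cStCharTSTorusDefs.torusChartHom L v) : Subgroup ((UnitaryGroup.LocalRing L v)ˣ × ↥(normOneUnits (conjLocal L (IsCMField.complexConj L) v)))) : Set ((UnitaryGroup.LocalRing L v)ˣ × ↥(normOneUnits (conjLocal L (IsCMField.complexConj L) v))))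
  · rw [Set.indicator_of_mem hm, Set.indicator_of_mem (hiff.2 hm)]
  · rw [Set.indicator_of_notMem hm, Set.indicator_of_notMem (fun h => hm (hiff.1 h))]

/-! ## §2 The glue -/

/-- **TWO-COSET IDENTITY ON `M_T` ⟹ THE SHELL FORMULA FOR `torusTransform` ON `M`.**  If `Δ(t)·O^{can}_t(φ) = κ_T·(𝟙_{ι(u)C_T}(t) + 𝟙_{ι(ω u)C_T}(t))` for every `t ∈ M_T`
(cosets as `{t | b⁻¹t ∈ C_T}`, the ★ p849606 shape; `C_T` an `ω`-stable level), then `F_φ = ((2 μM(M_c))⁻¹ κ_T)·(𝟙_{uC} + 𝟙_{uC}∘ω)` on `M` with `C = ι⁻¹(C_T)` — unfolding of ★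
`torusTransform` plus §1. [cite: Rogawski1990, §12.7 L. 12.7.2 (proof) pp. 193–194; §4.9 (4.9.4) p. 56] -/
theorem torusTransform_eq_of_twoCoset
    [MeasurableSpace (Gqs L v)] [∀ γ : Gqs L v, MeasurableSpace (Gqs L v ⧸ Subgroup.centralizer ({γ} : Set (Gqs L v)))]
    (mQv : OrbitalMeasureFamily (Gqs L v)) [MeasurableSpace ((UnitaryGroup.LocalRing L v)ˣ × ↥(normOneUnits (conjLocal L (IsCMField.complexConj L) v)))] (μM : Measure ((UnitaryGroup.LocalRing L v)ˣ × ↥(normOneUnits (conjLocal L (IsCMField.complexConj L) v))))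
    (CT : Subgroup ↥(cmBorelTriple L 3 v).M)
    (hCω : ∀ x : ((UnitaryGroup.LocalRing L v)ˣ × ↥(normOneUnits (conjLocal L (IsCMField.complexConj L) v))), F0P3cStCharTSTorusDefs.torusChart L v x ∈ CT → F0P3cStCharTSTorusDefs.torusChart L v ((fun p : ((UnitaryGroup.LocalRing L v)ˣ × ↥(normOneUnits (conjLocal L (IsCMField.complexConj L) v))) => ((Units.map ((conjLocal L (IsCMField.complexConj L) v : UnitaryGroup.LocalRing L v →+* UnitaryGroup.LocalRing L v) : UnitaryGroup.LocalRing L v →* UnitaryGroup.LocalRing L v) p.1)⁻¹, p.2)) x) ∈ CT)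
    (u : ((UnitaryGroup.LocalRing L v)ˣ × ↥(normOneUnits (conjLocal L (IsCMField.complexConj L) v)))) (φ : Gqs L v → ℂ) (κT : ℂ)
    (htwo : ∀ t : ↥(cmBorelTriple L 3 v).M,
      F0P3cStCharTSTorusDefs.vanDijkWeight L v t *
          classOrbitalIntegral mQv φ (ConjClasses.mk (((t : ↥(cmBorelTriple L 3 v).M) :
            ↥(unitaryGroupOfForm (conjLocal L (IsCMField.complexConj L) v) (cmLocalForm L 3 v))) : Gqs L v)) =
        κT * ({t' : ↥(cmBorelTriple L 3 v).M | (F0P3cStCharTSTorusDefs.torusChart L v u)⁻¹ * t' ∈ (CT : Set ↥(cmBorelTriple L 3 v).M)}.indicator (fun _ => (1 : ℂ)) t +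
          {t' : ↥(cmBorelTriple L 3 v).M | (F0P3cStCharTSTorusDefs.torusChart L v ((fun p : ((UnitaryGroup.LocalRing L v)ˣ × ↥(normOneUnits (conjLocal L (IsCMField.complexConj L) v))) => ((Units.map ((conjLocal L (IsCMField.complexConj L) v : UnitaryGroup.LocalRing L v →+* UnitaryGroup.LocalRing L v) : UnitaryGroup.LocalRing L v →* UnitaryGroup.LocalRing L v) p.1)⁻¹, p.2)) u))⁻¹ * t' ∈ (CT : Set ↥(cmBorelTriple L 3 v).M)}.indicator (fun _ => (1 : ℂ)) t)) :
    F0P3cStCharTSTorusDefs.torusTransform L v mQv μM φ = fun m =>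
      ((((2 * μM.real ((((Submonoid.pi Set.univ (fun w : PlacesOver L v => (w.1.adicCompletionIntegers L).toSubring.toSubmonoid)).units.prod (⊤ : Subgroup ↥(normOneUnits (conjLocal L (IsCMField.complexConj L) v)))) : Subgroup ((UnitaryGroup.LocalRing L v)ˣ × ↥(normOneUnits (conjLocal L (IsCMField.complexConj L) v)))) : Set ((UnitaryGroup.LocalRing L v)ˣ × ↥(normOneUnits (conjLocal L (IsCMField.complexConj L) v)))))⁻¹ : ℝ) : ℂ) * κT) *
        ((u • ((CT.comap (F0P3cStCharTSTorusDefs.torusChartHom L v) : Subgroup ((UnitaryGroup.LocalRing L v)ˣ × ↥(normOneUnits (conjLocal L (IsCMField.complexConj L) v)))) : Set ((UnitaryGroup.LocalRing L v)ˣ × ↥(normOneUnits (conjLocal L (IsCMField.complexConj L) v))))).indicator (fun _ => (1 : ℂ)) m +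
          (u • ((CT.comap (F0P3cStCharTSTorusDefs.torusChartHom L v) : Subgroup ((UnitaryGroup.LocalRing L v)ˣ × ↥(normOneUnits (conjLocal L (IsCMField.complexConj L) v)))) : Set ((UnitaryGroup.LocalRing L v)ˣ × ↥(normOneUnits (conjLocal L (IsCMField.complexConj L) v))))).indicator (fun _ => (1 : ℂ)) ((fun p : ((UnitaryGroup.LocalRing L v)ˣ × ↥(normOneUnits (conjLocal L (IsCMField.complexConj L) v))) => ((Units.map ((conjLocal L (IsCMField.complexConj L) v : UnitaryGroup.LocalRing L v →+* UnitaryGroup.LocalRing L v) : UnitaryGroup.LocalRing L v →* UnitaryGroup.LocalRing L v) p.1)⁻¹, p.2)) m)) := by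
  funext m
  simp only [F0P3cStCharTSTorusDefs.torusTransform]
  rw [htwo (F0P3cStCharTSTorusDefs.torusChart L v m), indicator_coset_torusChart L v CT u m, indicator_reflectCoset_torusChart L v CT hCω u m]
  ring

/-- `(2 μM(M_c))⁻¹ ≠ 0` for a Haar measure `μM` on `M` at a non-split `v` (`0 < μM(M_c) < ∞`, ★ p849333). [cite: Rogawski1990, §12.7 L. 12.7.2 (proof) p. 193] -/
theorem inv_two_mul_measureReal_torusCompactPart_ne_zero (hns : ∀ w : PlacesOver L v, IsCMField.complexConj L • w.1 = w.1)
    [MeasurableSpace ((UnitaryGroup.LocalRing L v)ˣ × ↥(normOneUnits (conjLocal L (IsCMField.complexConj L) v)))] [BorelSpace ((UnitaryGroup.LocalRing L v)ˣ × ↥(normOneUnits (conjLocal L (IsCMField.complexConj L) v)))] (μM : Measure ((UnitaryGroup.LocalRing L v)ˣ × ↥(normOneUnits (conjLocal L (IsCMField.complexConj L) v)))) [μM.IsHaarMeasure] :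
    ((((2 * μM.real ((((Submonoid.pi Set.univ (fun w : PlacesOver L v => (w.1.adicCompletionIntegers L).toSubring.toSubmonoid)).units.prod (⊤ : Subgroup ↥(normOneUnits (conjLocal L (IsCMField.complexConj L) v)))) : Subgroup ((UnitaryGroup.LocalRing L v)ˣ × ↥(normOneUnits (conjLocal L (IsCMField.complexConj L) v)))) : Set ((UnitaryGroup.LocalRing L v)ˣ × ↥(normOneUnits (conjLocal L (IsCMField.complexConj L) v)))))⁻¹ : ℝ) : ℂ)) ≠ 0 := by
  have hpos := F0P3cStCharTSTorusCompactPart.measure_real_torusCompactPart_pos L v μM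
    (F0P3cStCharTSTorusCompactPart.measure_torusCompactPart_lt_top L v hns μM)
  have h2 : (2 * μM.real ((((Submonoid.pi Set.univ (fun w : PlacesOver L v => (w.1.adicCompletionIntegers L).toSubring.toSubmonoid)).units.prod (⊤ : Subgroup ↥(normOneUnits (conjLocal L (IsCMField.complexConj L) v)))) : Subgroup ((UnitaryGroup.LocalRing L v)ˣ × ↥(normOneUnits (conjLocal L (IsCMField.complexConj L) v)))) : Set ((UnitaryGroup.LocalRing L v)ˣ × ↥(normOneUnits (conjLocal L (IsCMField.complexConj L) v)))))⁻¹ ≠ 0 := inv_ne_zero (mul_ne_zero two_ne_zero hpos.ne')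
  exact_mod_cast h2

/-- **«HSHELL-GLUE★» — the `hshell` clause of ★ p849718 ∕ p849745 at `(n, u)` from a two-coset identity.**  Given a smooth `φ` supported in `hyperbolicSet` (e.g. `𝟙_{K_n ι(u) K_n}`,
★ HYP-SET p849676) whose normalised canonical orbital integrals along `M_T` satisfy the two-coset identity with `κ_T ≠ 0` (road (D): ★ p849606 + Ψ-producer + F1-G +
«SHELL-WEIGHT★»), the shell clause holds with `C = ι⁻¹(C_T)` and `κ = (2 μM(M_c))⁻¹ κ_T`. [cite: Rogawski1990, §12.7 L. 12.7.1 (proof) p. 191; L. 12.7.2 (proof) pp. 193–194] -/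
theorem hshell_of_twoCoset (hns : ∀ w : PlacesOver L v, IsCMField.complexConj L • w.1 = w.1)
    [MeasurableSpace (Gqs L v)] [∀ γ : Gqs L v, MeasurableSpace (Gqs L v ⧸ Subgroup.centralizer ({γ} : Set (Gqs L v)))]
    (mQv : OrbitalMeasureFamily (Gqs L v)) [MeasurableSpace ((UnitaryGroup.LocalRing L v)ˣ × ↥(normOneUnits (conjLocal L (IsCMField.complexConj L) v)))] [BorelSpace ((UnitaryGroup.LocalRing L v)ˣ × ↥(normOneUnits (conjLocal L (IsCMField.complexConj L) v)))] (μM : Measure ((UnitaryGroup.LocalRing L v)ˣ × ↥(normOneUnits (conjLocal L (IsCMField.complexConj L) v)))) [μM.IsHaarMeasure]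
    (CT : Subgroup ↥(cmBorelTriple L 3 v).M)
    (hCω : ∀ x : ((UnitaryGroup.LocalRing L v)ˣ × ↥(normOneUnits (conjLocal L (IsCMField.complexConj L) v))), F0P3cStCharTSTorusDefs.torusChart L v x ∈ CT → F0P3cStCharTSTorusDefs.torusChart L v ((fun p : ((UnitaryGroup.LocalRing L v)ˣ × ↥(normOneUnits (conjLocal L (IsCMField.complexConj L) v))) => ((Units.map ((conjLocal L (IsCMField.complexConj L) v : UnitaryGroup.LocalRing L v →+* UnitaryGroup.LocalRing L v) : UnitaryGroup.LocalRing L v →* UnitaryGroup.LocalRing L v) p.1)⁻¹, p.2)) x) ∈ CT)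
    (u : ((UnitaryGroup.LocalRing L v)ˣ × ↥(normOneUnits (conjLocal L (IsCMField.complexConj L) v)))) (φ : Gqs L v → ℂ) (hφ : IsLocSmooth φ) (hφΩ : tsupport φ ⊆ F0P3cStCharTSTorusDefs.hyperbolicSet L v) (κT : ℂ) (hκT : κT ≠ 0)
    (htwo : ∀ t : ↥(cmBorelTriple L 3 v).M,
      F0P3cStCharTSTorusDefs.vanDijkWeight L v t *
          classOrbitalIntegral mQv φ (ConjClasses.mk (((t : ↥(cmBorelTriple L 3 v).M) :
            ↥(unitaryGroupOfForm (conjLocal L (IsCMField.complexConj L) v) (cmLocalForm L 3 v))) : Gqs L v)) =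
        κT * ({t' : ↥(cmBorelTriple L 3 v).M | (F0P3cStCharTSTorusDefs.torusChart L v u)⁻¹ * t' ∈ (CT : Set ↥(cmBorelTriple L 3 v).M)}.indicator (fun _ => (1 : ℂ)) t +
          {t' : ↥(cmBorelTriple L 3 v).M | (F0P3cStCharTSTorusDefs.torusChart L v ((fun p : ((UnitaryGroup.LocalRing L v)ˣ × ↥(normOneUnits (conjLocal L (IsCMField.complexConj L) v))) => ((Units.map ((conjLocal L (IsCMField.complexConj L) v : UnitaryGroup.LocalRing L v →+* UnitaryGroup.LocalRing L v) : UnitaryGroup.LocalRing L v →* UnitaryGroup.LocalRing L v) p.1)⁻¹, p.2)) u))⁻¹ * t' ∈ (CT : Set ↥(cmBorelTriple L 3 v).M)}.indicator (fun _ => (1 : ℂ)) t)) :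
    ∃ φ' : Gqs L v → ℂ, IsLocSmooth φ' ∧ tsupport φ' ⊆ F0P3cStCharTSTorusDefs.hyperbolicSet L v ∧ ∃ κ : ℂ, κ ≠ 0 ∧
      F0P3cStCharTSTorusDefs.torusTransform L v mQv μM φ' =
        fun m => κ * ((u • ((CT.comap (F0P3cStCharTSTorusDefs.torusChartHom L v) : Subgroup ((UnitaryGroup.LocalRing L v)ˣ × ↥(normOneUnits (conjLocal L (IsCMField.complexConj L) v)))) : Set ((UnitaryGroup.LocalRing L v)ˣ × ↥(normOneUnits (conjLocal L (IsCMField.complexConj L) v))))).indicator (fun _ => (1 : ℂ)) m +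
          (u • ((CT.comap (F0P3cStCharTSTorusDefs.torusChartHom L v) : Subgroup ((UnitaryGroup.LocalRing L v)ˣ × ↥(normOneUnits (conjLocal L (IsCMField.complexConj L) v)))) : Set ((UnitaryGroup.LocalRing L v)ˣ × ↥(normOneUnits (conjLocal L (IsCMField.complexConj L) v))))).indicator (fun _ => (1 : ℂ)) ((fun p : ((UnitaryGroup.LocalRing L v)ˣ × ↥(normOneUnits (conjLocal L (IsCMField.complexConj L) v))) => ((Units.map ((conjLocal L (IsCMField.complexConj L) v : UnitaryGroup.LocalRing L v →+* UnitaryGroup.LocalRing L v) : UnitaryGroup.LocalRing L v →* UnitaryGroup.LocalRing L v) p.1)⁻¹, p.2)) m)) :=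
  ⟨φ, hφ, hφΩ, _, mul_ne_zero (inv_two_mul_measureReal_torusCompactPart_ne_zero L v hns μM) hκT,
    torusTransform_eq_of_twoCoset L v mQv μM CT hCω u φ κT htwo⟩

end Summit.HodgeConjecture.HodgeConjecture.Cruxes.H413.F0P3cStCharTSHShellGlue

end
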